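/-
Copyright: the b2b-balaban T⁴-continuum CRUX team, row NE7b leaf lineage `t4-ne7b-formalise-leaf-04` (gen 145). Project licence.
-/
import Mathlib.Analysis.Calculus.LocalExtr.Basic
import Summits.QuantumFields.BalabanUV.T4Continuum.Spine.NE7b.ConvexTiltMoment

/-!
# THE CONVEXITY ROAD IN THE FIBRE FILES' COORDINATES: the owner's `ConvexTiltMoment` (on `EuclideanSpace ℝ (Fin n)`) transported to
# product-Lebesgue coordinates `ι → ℝ` — dot products, sums of squares, `fderiv`-form uniform convexity — the deferred junction
# «`EuclideanSpace ℝ (Fin n)` ↔ `(Fin n → ℝ)`: a transport, not done here» (row NE7b, node U5c; residual (R2′), family (2); kernel theorems)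

Cell `pub-balaban`, sub-cell `t4`, spine estimate NE7b (`T4WeightBudget.RelWeightBound`; the cell's OWN estimate — NOT PRINTED in
[Bałaban 1983–89], NOT PROVED).  Crux-route work under `Spine/NE7b/` by a row-NE7b leaf under the crux-prover clause of FREEZE (0);
NOTHING of Bałaban's is named or asserted; no `T4Continuum/Support` leaf typed; no `def`; zero `sorry`.

WHY.  The owner's `…NE7b.ConvexTiltMoment` types the convexity road for the Hessian-small remainder (refuter's price map κ-g67-5,
family (2); idea-1 T-60) on `EuclideanSpace ℝ (Fin n)`, the carrier of the tree's Brascamp–Lieb letter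
(`Literature.Probability.Moments.variance_tilted_le`): inner products `⟪u, x⟫`, Euclidean norms, `gradient`.  The fibre files it is
meant to serve — `…GaussianFibrewiseDecoupling`, `…LocalPerturbationSandwich`, `…StabilityWindowSandwich` — live on PRODUCT coordinates
`n₁ → ℝ`, `(n₁ ⊕ n₂) → ℝ` over arbitrary finite index types with the product Lebesgue measure, dot products `u ⬝ᵥ x` and matrices.
The owner's docstring books the junction as «coordinates `Fin n → ℝ` vs `EuclideanSpace`: a transport, not done here», and the
X-read chair (leaf-06 g146, X-CTM INFO-1) as «a junction lemma, rightly not here».  THIS FILE is that junction, and nothing else.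

WHAT IS PROVED ([folklore]; Mathlib's `PiLp.volume_preserving_ofLp`, `LinearIsometryEquiv.measurePreserving`,
`LinearIsometryEquiv.piLpCongrLeft`, `ContinuousLinearEquiv.comp_right_fderiv`, `InnerProductSpace.toDual_symm_apply`,
`MeasurePreserving.integral_comp` ∕ `integrable_comp_emb` ∕ `setIntegral_preimage_emb`, `integral_tilted`, and the owner's
`exp_moment_le_of_uniformlyConvex(_window)` BY NAME):
* §1 **A EUCLIDEAN CHART OF THE PRODUCT COORDINATES.**  For a continuous linear equivalence `T : EuclideanSpace ℝ (Fin n) ≃L[ℝ] (ι → ℝ)`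
  that is volume-preserving and reads the Euclidean norm as the sum of squares of the coordinates (`‖x‖² = Σ_i (T x i)²`):
  polarisation `⟪x, y⟫ = Σ_i T x i · T y i`, `⟪T⁻¹u, x⟫ = u ⬝ᵥ T x`, `‖T⁻¹u‖² = Σ_i u_i²`; the gradient pairing of a pulled-back
  function `⟪∇(V ∘ T) x, h⟫ = fderiv V (T x) (T h)`; uniform convexity in `fderiv` ∕ sum-of-squares form on `ι → ℝ` pulls back to the
  tree's `gradient` ∕ norm form; plain, windowed and TILTED integrals and integrabilities transport (`integral(_tilted)_comp_chart`, …);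
  and such a chart EXISTS for every finite `ι` (`exists_chart`: reindex `Fin (card ι) ≃ ι` by the `PiLp` isometry, then `ofLp`).
* §2 **`exp_moment_le_of_uniformlyConvex_pi`** — the owner's assembled bound in product letters: for `V : (ι → ℝ) → ℝ` continuous with
  `V x + fderiv ℝ V x (y − x) + (λ∕2)·Σ_i (y_i − x_i)² ≤ V y`, `e^{−V}` integrable, `q_k ≥ 0`, `u_k : ι → ℝ` with first and second
  moments of `u_k ⬝ᵥ x` under the tilt `ν_V = e^{−V}dx ∕ ∫e^{−V}`:
  `∫e^{−V} ≤ exp(Σ_k q_k·(λ⁻¹·Σ_i (u_k)_i² + m_k²)) · ∫e^{−(V + Σ_k q_k (u_k ⬝ᵥ x)²)}`, `m_k = ∫ u_k ⬝ᵥ x dν_V`;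
  and **`exp_moment_le_of_uniformlyConvex_window_pi`** — the same on a window `K ⊆ (ι → ℝ)` carrying the tilted mass fraction `1 − η`.
* §3 **THE SUBGRADIENT LETTER.**  A consumer who knows `V` is differentiable and has the first-order inequality with ANY vector field
  `dV` (`V x + dV x ⬝ᵥ (y − x) + (λ∕2)Σ_i (y_i − x_i)² ≤ V y`) need not identify `fderiv`: by Fermat's stationarity
  (`IsLocalMin.hasFDerivAt_eq_zero`) the inequality forces `fderiv ℝ V x h = dV x ⬝ᵥ h` (`fderiv_apply_eq_dotProduct_of_firstOrder`),
  whence **`exp_moment_le_of_uniformlyConvex_pi'`** ∕ **`…_window_pi'`** in the `dV` letter.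
* §4 **THE RANK-ONE FAMILY AS A MATRIX.**  `x ⬝ᵥ ((Σ_k q_k • vecMulVec u_k u_k) *ᵥ x) = Σ_k q_k (u_k ⬝ᵥ x)²` and
  `trace (Σ_k q_k • vecMulVec u_k u_k) = Σ_k q_k Σ_i (u_k)_i²` — so the exponent reads `tr(Q)∕λ + Σ_k q_k m_k²` for the fibre files'
  quadratic-form letter `x ⬝ᵥ Q *ᵥ x` whenever `Q` is GIVEN as a non-negative rank-one family (T-60a′'s `tr(Q)∕λ + mᵀQm` display).

NOT HERE (honest): the spectral decomposition of an arbitrary positive-semidefinite `Q` into such a family (the owner's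
`…QuadFormSimDiag` road supplies simultaneous diagonalisations where the instance needs them); uniform convexity of Bałaban's
small-field exponents (Δ4), the tilted means ((R1″)-class), the junction to the coupled-block letters proper (which `V`, which window —
the owner's call); anything of Bałaban's.  BY-NAME EFFECT ON THE WALL: NONE (a coordinate transport).  NE7b NOT PRINTED ∕ NOT PROVED;
spine PROVED 0∕9; rung (B)+1 on a FINITE torus — NOT infinite volume, NOT the mass gap, NOT Clay.
HONEST DEPENDENCY: continuum YM on T⁴ ⇐ BetaPertH ∧ nine spine estimates (0/9 proved); BetaPertH ⇐ (D1) ∧ (D4) ∧ CAP+tail.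
-/

set_option autoImplicit false

noncomputable section

open MeasureTheory Real Finset
open scoped RealInnerProductSpace

namespace Summit.QuantumFields.BalabanUV.T4Continuum.NE7b.ConvexTiltMomentPi

open Summit.QuantumFields.BalabanUV.T4Continuum.NE7b.ConvexTiltMoment

/-! ## §1 A Euclidean chart of the product coordinates -/

section Chart

variable {n : ℕ} {ι : Type*} [Fintype ι]

/-- **POLARISATION IN THE CHART**: if the linear chart `T` reads the Euclidean norm as the sum of squares of the coordinates, it reads
the inner product as the sum of products of the coordinates. [folklore] -/
theorem inner_eq_sum_chart (T : EuclideanSpace ℝ (Fin n) ≃L[ℝ] (ι → ℝ)) (hTn : ∀ x, ‖x‖ ^ 2 = ∑ i, T x i ^ 2)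
    (x y : EuclideanSpace ℝ (Fin n)) : ⟪x, y⟫ = ∑ i, T x i * T y i := by
  rw [real_inner_eq_norm_add_mul_self_sub_norm_mul_self_sub_norm_mul_self_div_two, ← sq, ← sq, ← sq, hTn, hTn, hTn]
  have e : ∑ i, (T (x + y)) i ^ 2 = ∑ i, T x i ^ 2 + ∑ i, T y i ^ 2 + 2 * ∑ i, T x i * T y i := by
    rw [Finset.mul_sum, ← Finset.sum_add_distrib, ← Finset.sum_add_distrib]
    refine Finset.sum_congr rfl fun i _ => ?_
    rw [map_add, Pi.add_apply]; ring
  rw [e]; ring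

/-- **THE PULLED-BACK COVECTOR IS THE DOT PRODUCT**: `⟪T⁻¹ u, x⟫ = u ⬝ᵥ T x`. [folklore] -/
theorem inner_symm_eq_dotProduct (T : EuclideanSpace ℝ (Fin n) ≃L[ℝ] (ι → ℝ)) (hTn : ∀ x, ‖x‖ ^ 2 = ∑ i, T x i ^ 2)
    (u : ι → ℝ) (x : EuclideanSpace ℝ (Fin n)) : ⟪T.symm u, x⟫ = u ⬝ᵥ T x := by
  rw [inner_eq_sum_chart T hTn, dotProduct]
  simp only [ContinuousLinearEquiv.apply_symm_apply]

/-- **ITS NORM IS THE SUM OF SQUARES**: `‖T⁻¹ u‖² = Σ_i u_i²`. [folklore] -/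
theorem norm_symm_sq (T : EuclideanSpace ℝ (Fin n) ≃L[ℝ] (ι → ℝ)) (hTn : ∀ x, ‖x‖ ^ 2 = ∑ i, T x i ^ 2) (u : ι → ℝ) :
    ‖T.symm u‖ ^ 2 = ∑ i, u i ^ 2 := by
  rw [hTn]; simp only [ContinuousLinearEquiv.apply_symm_apply]

/-- **THE GRADIENT PAIRING OF A PULLED-BACK FUNCTION**: `⟪∇(V ∘ T) x, h⟫ = fderiv V (T x) (T h)` (chain rule through the linear chart;
both sides vanish together where `V` is not differentiable). [folklore] -/
theorem inner_gradient_comp (T : EuclideanSpace ℝ (Fin n) ≃L[ℝ] (ι → ℝ)) (V : (ι → ℝ) → ℝ) (x h : EuclideanSpace ℝ (Fin n)) :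
    ⟪gradient (V ∘ ⇑T) x, h⟫ = fderiv ℝ V (T x) (T h) := by
  unfold gradient
  rw [InnerProductSpace.toDual_symm_apply, ContinuousLinearEquiv.comp_right_fderiv]
  rfl

/-- **UNIFORM CONVEXITY PULLS BACK**: the first-order `λ`-convexity of `V` on `ι → ℝ` in `fderiv` ∕ sum-of-squares form gives the
tree's `gradient` ∕ norm form for `V ∘ T` on `EuclideanSpace ℝ (Fin n)`. [folklore] -/
theorem uniformlyConvex_comp (T : EuclideanSpace ℝ (Fin n) ≃L[ℝ] (ι → ℝ)) (hTn : ∀ x, ‖x‖ ^ 2 = ∑ i, T x i ^ 2)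
    {V : (ι → ℝ) → ℝ} {lam : ℝ} (hV : ∀ x y : ι → ℝ, V x + fderiv ℝ V x (y - x) + lam / 2 * ∑ i, (y i - x i) ^ 2 ≤ V y)
    (x y : EuclideanSpace ℝ (Fin n)) :
    (V ∘ ⇑T) x + ⟪gradient (V ∘ ⇑T) x, y - x⟫ + lam / 2 * ‖y - x‖ ^ 2 ≤ (V ∘ ⇑T) y := by
  have h := hV (T x) (T y)
  rw [inner_gradient_comp, hTn]
  simpa only [Function.comp_apply, map_sub, Pi.sub_apply] using h

/-- The chart is a measurable embedding (a homeomorphism). -/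
theorem measurableEmbedding_chart (T : EuclideanSpace ℝ (Fin n) ≃L[ℝ] (ι → ℝ)) : MeasurableEmbedding (⇑T) :=
  T.toHomeomorph.measurableEmbedding

/-- **INTEGRALS TRANSPORT** along a volume-preserving chart. [folklore] -/
theorem integral_comp_chart (T : EuclideanSpace ℝ (Fin n) ≃L[ℝ] (ι → ℝ)) (hT : MeasurePreserving (⇑T) volume volume)
    (g : (ι → ℝ) → ℝ) : ∫ x, g (T x) = ∫ y, g y :=
  hT.integral_comp (measurableEmbedding_chart T) g

/-- **WINDOWED INTEGRALS TRANSPORT** (the window pulled back by the chart). [folklore] -/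
theorem setIntegral_comp_chart (T : EuclideanSpace ℝ (Fin n) ≃L[ℝ] (ι → ℝ)) (hT : MeasurePreserving (⇑T) volume volume)
    (g : (ι → ℝ) → ℝ) (K : Set (ι → ℝ)) : ∫ x in ⇑T ⁻¹' K, g (T x) = ∫ y in K, g y :=
  hT.setIntegral_preimage_emb (measurableEmbedding_chart T) g K

/-- **INTEGRABILITY TRANSPORTS.** [folklore] -/
theorem integrable_comp_chart_iff (T : EuclideanSpace ℝ (Fin n) ≃L[ℝ] (ι → ℝ)) (hT : MeasurePreserving (⇑T) volume volume)
    (g : (ι → ℝ) → ℝ) : Integrable (fun x => g (T x)) ↔ Integrable g :=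
  hT.integrable_comp_emb (measurableEmbedding_chart T)

/-- **TILTED INTEGRALS TRANSPORT**: `∫ g∘T dν_{V∘T} = ∫ g dν_V` for the tilts `ν_W = e^{−W}dx ∕ ∫e^{−W}` by the respective volumes.
[folklore] -/
theorem integral_tilted_comp_chart (T : EuclideanSpace ℝ (Fin n) ≃L[ℝ] (ι → ℝ)) (hT : MeasurePreserving (⇑T) volume volume)
    (V g : (ι → ℝ) → ℝ) :
    ∫ x, g (T x) ∂(volume.tilted fun x => -(V ∘ ⇑T) x) = ∫ y, g y ∂(volume.tilted fun y => -V y) := by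
  rw [integral_tilted, integral_tilted]
  have hZ : ∫ x : EuclideanSpace ℝ (Fin n), exp (-(V ∘ ⇑T) x) = ∫ y, exp (-V y) :=
    integral_comp_chart T hT (fun y => exp (-V y))
  rw [hZ]
  exact integral_comp_chart T hT (fun y => (exp (-V y) / ∫ y, exp (-V y)) • g y)

/-- **TILTED INTEGRABILITY TRANSPORTS.** [folklore] -/
theorem integrable_tilted_comp_chart_iff (T : EuclideanSpace ℝ (Fin n) ≃L[ℝ] (ι → ℝ))
    (hT : MeasurePreserving (⇑T) volume volume) {V : (ι → ℝ) → ℝ} (hZ : Integrable fun y => exp (-V y))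
    (g : (ι → ℝ) → ℝ) :
    Integrable (fun x => g (T x)) (volume.tilted fun x => -(V ∘ ⇑T) x) ↔ Integrable g (volume.tilted fun y => -V y) := by
  have hZ' : Integrable fun x : EuclideanSpace ℝ (Fin n) => exp (-(V ∘ ⇑T) x) :=
    (integrable_comp_chart_iff T hT (fun y => exp (-V y))).2 hZ
  rw [integrable_tilted_iff hZ', integrable_tilted_iff hZ]
  exact integrable_comp_chart_iff T hT (fun y => exp (-V y) • g y)

/-- **A CHART EXISTS FOR EVERY FINITE INDEX TYPE**: reindex `Fin (card ι) ≃ ι` by the `PiLp 2` isometry (volume-preserving as every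
linear isometry of finite-dimensional real Hilbert spaces), then `ofLp : EuclideanSpace ℝ ι → (ι → ℝ)` (volume-preserving by
`PiLp.volume_preserving_ofLp`); the norm is the sum of squares by `EuclideanSpace.real_norm_sq_eq`. [folklore] -/
theorem exists_chart (ι : Type*) [Fintype ι] :
    ∃ T : EuclideanSpace ℝ (Fin (Fintype.card ι)) ≃L[ℝ] (ι → ℝ),
      MeasurePreserving (⇑T) volume volume ∧ ∀ x, ‖x‖ ^ 2 = ∑ i, T x i ^ 2 := by
  let e : Fin (Fintype.card ι) ≃ ι := (Fintype.equivFin ι).symm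
  let L : EuclideanSpace ℝ (Fin (Fintype.card ι)) ≃ₗᵢ[ℝ] EuclideanSpace ℝ ι := LinearIsometryEquiv.piLpCongrLeft 2 ℝ ℝ e
  let P : EuclideanSpace ℝ ι ≃L[ℝ] (ι → ℝ) := PiLp.continuousLinearEquiv 2 ℝ (fun _ : ι => ℝ)
  refine ⟨L.toContinuousLinearEquiv.trans P, ?_, fun x => ?_⟩
  · exact (PiLp.volume_preserving_ofLp ι).comp L.measurePreserving
  · rw [← L.norm_map x, EuclideanSpace.real_norm_sq_eq]
    rfl

end Chart

/-! ## §2 The convexity road in product coordinates -/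

section Pi

variable {ι : Type*} [Fintype ι]

/-- **THE CONVEXITY ROAD, ASSEMBLED, IN PRODUCT COORDINATES** (the owner's `ConvexTiltMoment.exp_moment_le_of_uniformlyConvex`
transported along a chart of §1).  For `V : (ι → ℝ) → ℝ` continuous and `λ`-uniformly convex in the first-order sense
(`V x + fderiv ℝ V x (y − x) + (λ∕2)·Σ_i (y_i − x_i)² ≤ V y`; `fderiv` is `0` where `V` is not differentiable, so the letter then asks a
strict minimum — as in the tree), `e^{−V}` integrable for the product Lebesgue measure, and a sacrificed form `g = Σ_k q_k (u_k ⬝ᵥ x)²`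
with `q_k ≥ 0` whose linear functionals have first and second moments under the tilt `ν_V = e^{−V}dx ∕ ∫e^{−V}`:
`∫e^{−V} ≤ exp(Σ_k q_k·(λ⁻¹·Σ_i (u_k)_i² + m_k²)) · ∫e^{−(V + g)}`, `m_k = ∫ u_k ⬝ᵥ x dν_V`. [folklore] -/
theorem exp_moment_le_of_uniformlyConvex_pi {V : (ι → ℝ) → ℝ} {lam : ℝ} {r : ℕ} (hlam : 0 < lam) (hVc : Continuous V)
    (hV : ∀ x y : ι → ℝ, V x + fderiv ℝ V x (y - x) + lam / 2 * ∑ i, (y i - x i) ^ 2 ≤ V y)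
    (hZ : Integrable fun x => exp (-V x)) (q : Fin r → ℝ) (hq : ∀ k, 0 ≤ q k) (u : Fin r → ι → ℝ)
    (h1 : ∀ k, Integrable (fun x => u k ⬝ᵥ x) (volume.tilted fun x => -V x))
    (h2 : ∀ k, Integrable (fun x => (u k ⬝ᵥ x) ^ 2) (volume.tilted fun x => -V x)) :
    ∫ x, exp (-V x) ≤
      exp (∑ k, q k * (lam⁻¹ * ∑ i, u k i ^ 2 + (∫ x, u k ⬝ᵥ x ∂(volume.tilted fun x => -V x)) ^ 2)) *
        ∫ x, exp (-(V x + ∑ k, q k * (u k ⬝ᵥ x) ^ 2)) := by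
  obtain ⟨T, hT, hTn⟩ := exists_chart ι
  -- the pulled-back data
  have hVc' : Continuous (V ∘ ⇑T) := hVc.comp T.continuous
  have hV' := uniformlyConvex_comp T hTn hV
  have hZ' : Integrable fun x => exp (-(V ∘ ⇑T) x) := (integrable_comp_chart_iff T hT (fun y => exp (-V y))).2 hZ
  have ei : ∀ k x, ⟪T.symm (u k), x⟫ = u k ⬝ᵥ T x := fun k x => inner_symm_eq_dotProduct T hTn (u k) x
  have h1' : ∀ k, Integrable (fun x => ⟪T.symm (u k), x⟫) (volume.tilted fun x => -(V ∘ ⇑T) x) := fun k => by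
    simp_rw [ei]; exact (integrable_tilted_comp_chart_iff T hT hZ (fun y => u k ⬝ᵥ y)).2 (h1 k)
  have h2' : ∀ k, Integrable (fun x => ⟪T.symm (u k), x⟫ ^ 2) (volume.tilted fun x => -(V ∘ ⇑T) x) := fun k => by
    simp_rw [ei]; exact (integrable_tilted_comp_chart_iff T hT hZ (fun y => (u k ⬝ᵥ y) ^ 2)).2 (h2 k)
  have key := exp_moment_le_of_uniformlyConvex hlam hVc' hV' hZ' q hq (fun k => T.symm (u k)) h1' h2'
  -- read every term back in product coordinates
  have eZ : ∫ x, exp (-(V ∘ ⇑T) x) = ∫ y, exp (-V y) := integral_comp_chart T hT (fun y => exp (-V y))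
  have em : ∀ k, ∫ x, ⟪T.symm (u k), x⟫ ∂(volume.tilted fun x => -(V ∘ ⇑T) x) =
      ∫ y, u k ⬝ᵥ y ∂(volume.tilted fun y => -V y) := fun k => by
    simp_rw [ei]; exact integral_tilted_comp_chart T hT V (fun y => u k ⬝ᵥ y)
  have eW : ∫ x, exp (-((V ∘ ⇑T) x + ∑ k, q k * ⟪T.symm (u k), x⟫ ^ 2)) =
      ∫ y, exp (-(V y + ∑ k, q k * (u k ⬝ᵥ y) ^ 2)) := by
    simp_rw [ei]; exact integral_comp_chart T hT (fun y => exp (-(V y + ∑ k, q k * (u k ⬝ᵥ y) ^ 2)))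
  simp_rw [norm_symm_sq T hTn, em, eZ, eW] at key
  exact key

/-- **THE CONVEXITY ROAD ON A WINDOW, IN PRODUCT COORDINATES** (the owner's `…exp_moment_le_of_uniformlyConvex_window` transported):
same data, and a window `K ⊆ (ι → ℝ)` carrying the fraction `1 − η` (`η < 1`) of the tilted mass; then
`∫_K e^{−V} ≤ exp((Σ_k q_k·(λ⁻¹·Σ_i (u_k)_i² + m_k²)) ∕ (1−η)) · ∫_K e^{−(V+g)}`. [folklore] -/
theorem exp_moment_le_of_uniformlyConvex_window_pi {V : (ι → ℝ) → ℝ} {lam η : ℝ} {r : ℕ} (hlam : 0 < lam)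
    (hVc : Continuous V)
    (hV : ∀ x y : ι → ℝ, V x + fderiv ℝ V x (y - x) + lam / 2 * ∑ i, (y i - x i) ^ 2 ≤ V y)
    (hZ : Integrable fun x => exp (-V x)) (q : Fin r → ℝ) (hq : ∀ k, 0 ≤ q k) (u : Fin r → ι → ℝ)
    (h1 : ∀ k, Integrable (fun x => u k ⬝ᵥ x) (volume.tilted fun x => -V x))
    (h2 : ∀ k, Integrable (fun x => (u k ⬝ᵥ x) ^ 2) (volume.tilted fun x => -V x))
    (K : Set (ι → ℝ)) (hη : η < 1) (hmass : (1 - η) * ∫ x, exp (-V x) ≤ ∫ x in K, exp (-V x)) :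
    ∫ x in K, exp (-V x) ≤
      exp ((∑ k, q k * (lam⁻¹ * ∑ i, u k i ^ 2 + (∫ x, u k ⬝ᵥ x ∂(volume.tilted fun x => -V x)) ^ 2)) / (1 - η)) *
        ∫ x in K, exp (-(V x + ∑ k, q k * (u k ⬝ᵥ x) ^ 2)) := by
  obtain ⟨T, hT, hTn⟩ := exists_chart ι
  have hVc' : Continuous (V ∘ ⇑T) := hVc.comp T.continuous
  have hV' := uniformlyConvex_comp T hTn hV
  have hZ' : Integrable fun x => exp (-(V ∘ ⇑T) x) := (integrable_comp_chart_iff T hT (fun y => exp (-V y))).2 hZ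
  have ei : ∀ k x, ⟪T.symm (u k), x⟫ = u k ⬝ᵥ T x := fun k x => inner_symm_eq_dotProduct T hTn (u k) x
  have h1' : ∀ k, Integrable (fun x => ⟪T.symm (u k), x⟫) (volume.tilted fun x => -(V ∘ ⇑T) x) := fun k => by
    simp_rw [ei]; exact (integrable_tilted_comp_chart_iff T hT hZ (fun y => u k ⬝ᵥ y)).2 (h1 k)
  have h2' : ∀ k, Integrable (fun x => ⟪T.symm (u k), x⟫ ^ 2) (volume.tilted fun x => -(V ∘ ⇑T) x) := fun k => by
    simp_rw [ei]; exact (integrable_tilted_comp_chart_iff T hT hZ (fun y => (u k ⬝ᵥ y) ^ 2)).2 (h2 k)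
  have eZ : ∫ x, exp (-(V ∘ ⇑T) x) = ∫ y, exp (-V y) := integral_comp_chart T hT (fun y => exp (-V y))
  have eK : ∫ x in ⇑T ⁻¹' K, exp (-(V ∘ ⇑T) x) = ∫ y in K, exp (-V y) :=
    setIntegral_comp_chart T hT (fun y => exp (-V y)) K
  have hmass' : (1 - η) * ∫ x, exp (-(V ∘ ⇑T) x) ≤ ∫ x in ⇑T ⁻¹' K, exp (-(V ∘ ⇑T) x) := by
    rw [eZ, eK]; exact hmass
  have key := exp_moment_le_of_uniformlyConvex_window hlam hVc' hV' hZ' q hq (fun k => T.symm (u k)) h1' h2'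
    (⇑T ⁻¹' K) hη hmass'
  have em : ∀ k, ∫ x, ⟪T.symm (u k), x⟫ ∂(volume.tilted fun x => -(V ∘ ⇑T) x) =
      ∫ y, u k ⬝ᵥ y ∂(volume.tilted fun y => -V y) := fun k => by
    simp_rw [ei]; exact integral_tilted_comp_chart T hT V (fun y => u k ⬝ᵥ y)
  have eW : ∫ x in ⇑T ⁻¹' K, exp (-((V ∘ ⇑T) x + ∑ k, q k * ⟪T.symm (u k), x⟫ ^ 2)) =
      ∫ y in K, exp (-(V y + ∑ k, q k * (u k ⬝ᵥ y) ^ 2)) := by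
    simp_rw [ei]; exact setIntegral_comp_chart T hT (fun y => exp (-(V y + ∑ k, q k * (u k ⬝ᵥ y) ^ 2))) K
  simp_rw [norm_symm_sq T hTn, em, eK, eW] at key
  exact key

end Pi

/-! ## §3 The subgradient letter: any vector field in the first-order inequality is the derivative -/

section Subgradient

variable {ι : Type*} [Fintype ι]

/-- **FERMAT READS THE SUBGRADIENT**: if `V` is differentiable at `x` and satisfies the first-order inequality
`V x + dV x ⬝ᵥ (y − x) + (λ∕2)·Σ_i (y_i − x_i)² ≤ V y` for all `y` with SOME vector `dV x` (any real `λ`), then `fderiv ℝ V x h = dV x ⬝ᵥ h`: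
the function `y ↦ V y − dV x ⬝ᵥ (y − x) − (λ∕2)Σ_i (y_i − x_i)²` is minimal at `x`, so its derivative there vanishes
(`IsLocalMin.hasFDerivAt_eq_zero`). [folklore] -/
theorem fderiv_apply_eq_dotProduct_of_firstOrder {V : (ι → ℝ) → ℝ} {lam : ℝ} {dV : (ι → ℝ) → (ι → ℝ)} {x : ι → ℝ}
    (hVd : DifferentiableAt ℝ V x) (hV : ∀ y : ι → ℝ, V x + dV x ⬝ᵥ (y - x) + lam / 2 * ∑ i, (y i - x i) ^ 2 ≤ V y)
    (h : ι → ℝ) : fderiv ℝ V x h = dV x ⬝ᵥ h := by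
  classical
  -- the covector `z ↦ dV x ⬝ᵥ z` as a continuous linear map
  let L : (ι → ℝ) →L[ℝ] ℝ := ∑ i, dV x i • ContinuousLinearMap.proj (R := ℝ) (φ := fun _ : ι => ℝ) i
  have hL : ∀ z : ι → ℝ, L z = dV x ⬝ᵥ z := fun z => by
    simp [L, dotProduct]
  -- derivatives at `x` of the affine and the quadratic correction
  have hP : ∀ i, HasFDerivAt (fun y : ι → ℝ => y i - x i) (ContinuousLinearMap.proj (R := ℝ) (φ := fun _ : ι => ℝ) i) x :=
    fun i => (hasFDerivAt_apply i x).sub_const (x i)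
  have hQ : HasFDerivAt (fun y : ι → ℝ => ∑ i, (y i - x i) ^ 2) (0 : (ι → ℝ) →L[ℝ] ℝ) x := by
    have hterm : ∀ i ∈ (Finset.univ : Finset ι),
        HasFDerivAt (fun y : ι → ℝ => (y i - x i) ^ 2) (0 : (ι → ℝ) →L[ℝ] ℝ) x := fun i _ => by
      have hm := (hP i).fun_mul (hP i)
      simp only [sub_self, zero_smul, add_zero] at hm
      simpa only [sq] using hm
    simpa only [Finset.sum_const_zero] using HasFDerivAt.fun_sum hterm
  have hA : HasFDerivAt (fun y : ι → ℝ => dV x ⬝ᵥ (y - x)) L x := by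
    have h0 : HasFDerivAt (fun y : ι → ℝ => L y - L x) L x := L.hasFDerivAt.sub_const (L x)
    refine h0.congr_of_eventuallyEq (Filter.Eventually.of_forall fun y => ?_)
    show dV x ⬝ᵥ (y - x) = L y - L x
    rw [← map_sub, hL]
  -- the gap function and its stationarity at the minimum `x`
  have hφ : HasFDerivAt (fun y : ι → ℝ => V y - dV x ⬝ᵥ (y - x) - lam / 2 * ∑ i, (y i - x i) ^ 2)
      (fderiv ℝ V x - L - (lam / 2) • (0 : (ι → ℝ) →L[ℝ] ℝ)) x :=
    (hVd.hasFDerivAt.sub hA).sub (hQ.const_mul (lam / 2))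
  have hmin : IsLocalMin (fun y : ι → ℝ => V y - dV x ⬝ᵥ (y - x) - lam / 2 * ∑ i, (y i - x i) ^ 2) x :=
    Filter.Eventually.of_forall fun y => by
      have hy := hV y
      simp only [sub_self, dotProduct_zero, ne_eq, OfNat.ofNat_ne_zero, not_false_eq_true, zero_pow,
        Finset.sum_const_zero, mul_zero, sub_zero]
      linarith
  have h0 := IsLocalMin.hasFDerivAt_eq_zero hmin hφ
  rw [smul_zero, sub_zero, sub_eq_zero] at h0
  rw [h0, hL]

/-- The `dV`-letter gives the `fderiv`-letter of §2 for a differentiable `V`. [folklore] -/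
theorem firstOrder_fderiv_of_dV {V : (ι → ℝ) → ℝ} {lam : ℝ} {dV : (ι → ℝ) → (ι → ℝ)} (hVd : Differentiable ℝ V)
    (hV : ∀ x y : ι → ℝ, V x + dV x ⬝ᵥ (y - x) + lam / 2 * ∑ i, (y i - x i) ^ 2 ≤ V y) (x y : ι → ℝ) :
    V x + fderiv ℝ V x (y - x) + lam / 2 * ∑ i, (y i - x i) ^ 2 ≤ V y := by
  rw [fderiv_apply_eq_dotProduct_of_firstOrder (hVd x) (hV x)]
  exact hV x y

/-- **THE CONVEXITY ROAD IN PRODUCT COORDINATES, SUBGRADIENT LETTER**: `exp_moment_le_of_uniformlyConvex_pi` for a differentiable `V`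
with the first-order inequality stated through ANY vector field `dV` (the consumer's explicit gradient formula; no identification of
`fderiv` owed). [folklore] -/
theorem exp_moment_le_of_uniformlyConvex_pi' {V : (ι → ℝ) → ℝ} {lam : ℝ} {r : ℕ} (hlam : 0 < lam) (hVd : Differentiable ℝ V)
    (dV : (ι → ℝ) → (ι → ℝ)) (hV : ∀ x y : ι → ℝ, V x + dV x ⬝ᵥ (y - x) + lam / 2 * ∑ i, (y i - x i) ^ 2 ≤ V y)
    (hZ : Integrable fun x => exp (-V x)) (q : Fin r → ℝ) (hq : ∀ k, 0 ≤ q k) (u : Fin r → ι → ℝ)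
    (h1 : ∀ k, Integrable (fun x => u k ⬝ᵥ x) (volume.tilted fun x => -V x))
    (h2 : ∀ k, Integrable (fun x => (u k ⬝ᵥ x) ^ 2) (volume.tilted fun x => -V x)) :
    ∫ x, exp (-V x) ≤
      exp (∑ k, q k * (lam⁻¹ * ∑ i, u k i ^ 2 + (∫ x, u k ⬝ᵥ x ∂(volume.tilted fun x => -V x)) ^ 2)) *
        ∫ x, exp (-(V x + ∑ k, q k * (u k ⬝ᵥ x) ^ 2)) :=
  exp_moment_le_of_uniformlyConvex_pi hlam hVd.continuous (firstOrder_fderiv_of_dV hVd hV) hZ q hq u h1 h2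

/-- **THE WINDOWED ROAD IN PRODUCT COORDINATES, SUBGRADIENT LETTER.** [folklore] -/
theorem exp_moment_le_of_uniformlyConvex_window_pi' {V : (ι → ℝ) → ℝ} {lam η : ℝ} {r : ℕ} (hlam : 0 < lam)
    (hVd : Differentiable ℝ V) (dV : (ι → ℝ) → (ι → ℝ))
    (hV : ∀ x y : ι → ℝ, V x + dV x ⬝ᵥ (y - x) + lam / 2 * ∑ i, (y i - x i) ^ 2 ≤ V y)
    (hZ : Integrable fun x => exp (-V x)) (q : Fin r → ℝ) (hq : ∀ k, 0 ≤ q k) (u : Fin r → ι → ℝ)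
    (h1 : ∀ k, Integrable (fun x => u k ⬝ᵥ x) (volume.tilted fun x => -V x))
    (h2 : ∀ k, Integrable (fun x => (u k ⬝ᵥ x) ^ 2) (volume.tilted fun x => -V x))
    (K : Set (ι → ℝ)) (hη : η < 1) (hmass : (1 - η) * ∫ x, exp (-V x) ≤ ∫ x in K, exp (-V x)) :
    ∫ x in K, exp (-V x) ≤
      exp ((∑ k, q k * (lam⁻¹ * ∑ i, u k i ^ 2 + (∫ x, u k ⬝ᵥ x ∂(volume.tilted fun x => -V x)) ^ 2)) / (1 - η)) *
        ∫ x in K, exp (-(V x + ∑ k, q k * (u k ⬝ᵥ x) ^ 2)) :=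
  exp_moment_le_of_uniformlyConvex_window_pi hlam hVd.continuous (firstOrder_fderiv_of_dV hVd hV) hZ q hq u h1 h2 K hη hmass

end Subgradient

/-! ## §4 The rank-one family as a matrix: the fibre files' quadratic-form letter and the trace display -/

section RankOne

open scoped Matrix

variable {ι : Type*} [Fintype ι] {r : ℕ}

/-- **THE SACRIFICED FORM AS A QUADRATIC FORM**: `x ⬝ᵥ ((Σ_k q_k • u_k u_kᵀ) *ᵥ x) = Σ_k q_k (u_k ⬝ᵥ x)²`. [folklore] -/
theorem dotProduct_rankOneFamily_mulVec (q : Fin r → ℝ) (u : Fin r → ι → ℝ) (x : ι → ℝ) :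
    x ⬝ᵥ ((∑ k, q k • Matrix.vecMulVec (u k) (u k)) *ᵥ x) = ∑ k, q k * (u k ⬝ᵥ x) ^ 2 := by
  rw [Matrix.sum_mulVec, dotProduct_sum]
  refine Finset.sum_congr rfl fun k _ => ?_
  rw [Matrix.smul_mulVec, Matrix.vecMulVec_mulVec, op_smul_eq_smul, smul_smul, dotProduct_smul, smul_eq_mul,
    dotProduct_comm x (u k), sq, mul_assoc]

/-- **ITS TRACE IS THE WEIGHTED SUM OF SQUARES**: `tr(Σ_k q_k • u_k u_kᵀ) = Σ_k q_k Σ_i (u_k)_i²` — the `λ⁻¹·Σ_k q_k Σ_i (u_k)_i²` of §2 is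
`tr(Q)∕λ` (T-60a′'s display). [folklore] -/
theorem trace_rankOneFamily (q : Fin r → ℝ) (u : Fin r → ι → ℝ) :
    Matrix.trace (∑ k, q k • Matrix.vecMulVec (u k) (u k)) = ∑ k, q k * ∑ i, u k i ^ 2 := by
  rw [Matrix.trace_sum]
  refine Finset.sum_congr rfl fun k _ => ?_
  rw [Matrix.trace_smul, Matrix.trace_vecMulVec, smul_eq_mul, dotProduct]
  simp_rw [sq]

/-- **THE EXPONENT IN THE TRACE DISPLAY**: with `Q = Σ_k q_k • u_k u_kᵀ`,
`Σ_k q_k·(λ⁻¹·Σ_i (u_k)_i² + m_k²) = λ⁻¹·tr(Q) + Σ_k q_k m_k²`. [folklore] -/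
theorem exponent_eq_trace_add (q : Fin r → ℝ) (u : Fin r → ι → ℝ) (lam : ℝ) (m : Fin r → ℝ) :
    ∑ k, q k * (lam⁻¹ * ∑ i, u k i ^ 2 + m k ^ 2) =
      lam⁻¹ * Matrix.trace (∑ k, q k • Matrix.vecMulVec (u k) (u k)) + ∑ k, q k * m k ^ 2 := by
  rw [trace_rankOneFamily, Finset.mul_sum, ← Finset.sum_add_distrib]
  exact Finset.sum_congr rfl fun k _ => by ring

end RankOne

end Summit.QuantumFields.BalabanUV.T4Continuum.NE7b.ConvexTiltMomentPi

end
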